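import Summits.ValiantsHypothesis.ValiantsHypothesis.Theorems.SymPencilHomogeneousDrop
import Summits.ValiantsHypothesis.ValiantsHypothesis.Theorems.SymPencilKernelRowRank
import Literature.Computability.AlgebraicComplexity.AlperBogartVelascoLowOrder

/-!
# Route `SymPencil` — the Hessian rank of a HOMOGENEOUS symmetric determinant drops by one
# (tool for the cruxes `SdcPerSq` stmt-ValiantsHypothesis-5675 / `SdcPerBeyondN` stmt-5676)

**Theorem** (`rank_hessianMatrix_le_card_of_isHomogeneous`). Let `k` be a field of
characteristic `0`, `f ∈ k[σ]` homogeneous of degree `n`, `A` a SYMMETRIC `ι × ι` matrix of affine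
linear forms with `det A = f` (`|ι| = m`, `n ≤ m`, `m ≠ n`), and `x` a zero of `f` with
`rank A(x) ≥ m - 1`.  Then `rank Hess f (x) ≤ m` — one less than the symmetric Mignon–Ressayre
bound `m + 1` (`HessianRankSymmDet`, tree
`rank_hessianMatrix_le_card_add_one_of_isAffineDetRepr_of_isSymm`), which is attained only by
pencils representing forms of degree exactly `m` (e.g. the generic symmetric determinant).

Proof.  `Hess f (x) = Lᵀ · Hess DET (Y) · L` (affine chain rule, `Y = A(x)`, columns of `L` the
symmetric coefficient matrices `A_v`).  The tree's two-sided vanishing lemma and the rank-one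
splitting of `rank_transpose_mul_mul_le_card_add_one` give in fact
`rank Hess f (x) ≤ rank (y ↦ M(y) w) + 1` (`SymPencilKernelRowRank.rank_transpose_mul_mul_le_rank_add_one`, `w` spanning
`ker Y`, `M(y) = Σ y_v A_v`).  If the kernel-row map `y ↦ M(y) w` is onto `k^ι`, homogeneity
`f (c z) = c ^ n f (z)` yields `det (Y + M(y) + ν A₀) = (1 + ν)^(m-n) det (Y + M(y))` and, in a
basis through `w` (`Y ≅ 0 ⊕ Δ`), the normal-form core lemma
`SymPencilHomogeneousDrop.eq_zero_of_det_add_smul` forces `m - n = 0`, a contradiction; so the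
map has rank `≤ m - 1` and `rank Hess f (x) ≤ m`.

Consequence (separate file `SymPencilSdcPerSq.lean`): `sdc(per_n) ≥ n²` for all `n ≥ 3`
(crux `SdcPerSq`), since `rank Hess per_n (y₀) = n²` at the Mignon–Ressayre point and
`rank A(y₀) = m - 1` by Alper–Bogart–Velasco regularity. [folklore]
-/

noncomputable section

-- single-conjunct layout: Sub = Summit, duplicated namespace component intended
set_option linter.dupNamespace false

namespace Summit.ValiantsHypothesis.ValiantsHypothesis.Theorems.SymPencilHomogeneousHessianRank

open Matrix MvPolynomial
open Literature.Computability.AlgebraicComplexity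
open Summit.ValiantsHypothesis.ValiantsHypothesis.Theorems.SymPencilHomogeneousDropTools
open Summit.ValiantsHypothesis.ValiantsHypothesis.Theorems.SymPencilHomogeneousDrop
open Summit.ValiantsHypothesis.ValiantsHypothesis.Theorems.SymPencilKernelRowRank

universe u

variable {k : Type u} [Field k]

/-! ### From the kernel-row map to the normal form -/

section Bridge

variable [CharZero k] {V : Type*} [AddCommGroup V] [Module k V]

/-- **Bridge, split index.** On `Unit ⊕ ι'` with a kernel vector `w` of the symmetric corank-`1`
matrix `Y` having `w₀ ≠ 0`: the congruence by `P = [[w₀, 0], [w', 1]]` (first column `w`) puts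
`Y` in the form `0 ⊕ Δ` and transports the homogeneity identity and the surjectivity of the
kernel-row map `v ↦ M(v) w` to the hypotheses of `eq_zero_of_det_add_smul`. [folklore] -/
theorem eq_zero_of_kernelRow_surjective_sum {ι' : Type*} [Fintype ι'] [DecidableEq ι']
    (Y A₀ : Matrix (Unit ⊕ ι') (Unit ⊕ ι') k) (hYs : Yᵀ = Y) (hA₀s : A₀ᵀ = A₀)
    (w : Unit ⊕ ι' → k) (hw0 : w (Sum.inl ()) ≠ 0) (hYw : Y *ᵥ w = 0)
    (hrank : Fintype.card ι' ≤ Y.rank) (M : V →ₗ[k] Matrix (Unit ⊕ ι') (Unit ⊕ ι') k)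
    (hMs : ∀ v, (M v)ᵀ = M v) (j : ℕ)
    (hH : ∀ (v : V) (ν : k), ν ≠ -1 → (Y + M v + ν • A₀).det = (1 + ν) ^ j * (Y + M v).det)
    (hS : ∀ u : Unit ⊕ ι' → k, ∃ v, M v *ᵥ w = u) : j = 0 := by
  classical
  -- the congruence matrix `P` with first column `w`
  set P : Matrix (Unit ⊕ ι') (Unit ⊕ ι') k := Matrix.fromBlocks (w (Sum.inl ()) • 1) 0
    (Matrix.replicateCol Unit fun i => w (Sum.inr i)) 1 with hPdef
  have hPcol : ∀ b, P b (Sum.inl ()) = w b := by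
    rintro (b | b)
    · simp [hPdef]
    · simp [hPdef]
  have hPinr : ∀ (b : Unit ⊕ ι') (j : ι'), P b (Sum.inr j) = if b = Sum.inr j then 1 else 0 := by
    rintro (b | b) j
    · simp [hPdef]
    · simp [hPdef, Matrix.one_apply]
  have hPdet : P.det = w (Sum.inl ()) := by
    rw [hPdef, Matrix.det_fromBlocks_zero₁₂, Matrix.det_one, mul_one, Matrix.det_smul,
      Matrix.det_one, mul_one, Fintype.card_unit, pow_one]
  have hPu : IsUnit P.det := isUnit_iff_ne_zero.2 (by rw [hPdet]; exact hw0)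
  have hPtu : IsUnit Pᵀ.det := by rwa [Matrix.det_transpose]
  -- first column of a congruent matrix, and the lower-right block
  have hcol : ∀ (N : Matrix (Unit ⊕ ι') (Unit ⊕ ι') k) (i : Unit ⊕ ι'),
      (Pᵀ * N * P) i (Sum.inl ()) = (Pᵀ *ᵥ (N *ᵥ w)) i := by
    intro N i
    rw [Matrix.mulVec_mulVec, Matrix.mul_apply, Matrix.mulVec, dotProduct]
    simp_rw [hPcol]
  have hblock : ∀ (N : Matrix (Unit ⊕ ι') (Unit ⊕ ι') k) (i j : ι'),
      (Pᵀ * N * P) (Sum.inr i) (Sum.inr j) = N (Sum.inr i) (Sum.inr j) := by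
    intro N i j
    simp only [Matrix.mul_apply, Matrix.transpose_apply, hPinr, ite_mul, one_mul, zero_mul,
      mul_ite, mul_one, mul_zero, Finset.sum_ite_eq', Finset.mem_univ, if_true]
  have hsymm : ∀ N : Matrix (Unit ⊕ ι') (Unit ⊕ ι') k, Nᵀ = N → (Pᵀ * N * P)ᵀ = Pᵀ * N * P := by
    intro N hN
    rw [Matrix.transpose_mul, Matrix.transpose_mul, Matrix.transpose_transpose, hN,
      Matrix.mul_assoc]
  -- the normal form of `Y`
  set Δ : Matrix ι' ι' k := Y.toBlocks₂₂ with hΔdef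
  have hYnf : Pᵀ * Y * P = Matrix.fromBlocks 0 0 0 Δ := by
    have hc : ∀ i, (Pᵀ * Y * P) i (Sum.inl ()) = 0 := fun i => by
      rw [hcol, hYw, Matrix.mulVec_zero, Pi.zero_apply]
    ext (i | i) (j | j)
    · rw [hc]; simp
    · have h := hc (Sum.inr j)
      rw [← hsymm Y hYs, Matrix.transpose_apply] at h
      rw [h]; simp
    · rw [hc]; simp
    · rw [hblock]; simp [hΔdef, Matrix.toBlocks₂₂]
  have hΔs : Δᵀ = Δ := by
    ext i j
    simp only [hΔdef, Matrix.toBlocks₂₂, Matrix.transpose_apply, Matrix.of_apply]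
    rw [← hYs, Matrix.transpose_apply, hYs]
  -- `Δ` is invertible: `rank Y = rank (0 ⊕ Δ) ≤ rank Δ`
  have hΔ : IsUnit Δ.det := by
    rw [isUnit_iff_ne_zero]
    intro hΔ0
    have hlt := Matrix.rank_lt_card_of_det_eq_zero hΔ0
    have h1 : (Pᵀ * Y * P).rank = Y.rank := by
      rw [Matrix.rank_mul_eq_left_of_isUnit_det _ _ hPu, Matrix.rank_mul_eq_right_of_isUnit_det _ _ hPtu]
    have h2 : (Matrix.fromBlocks (0 : Matrix Unit Unit k) 0 0 Δ).rank ≤ Δ.rank := by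
      have hf : Matrix.fromBlocks (0 : Matrix Unit Unit k) 0 0 Δ =
          Matrix.fromRows (0 : Matrix Unit ι' k) (1 : Matrix ι' ι' k) * Δ *
            Matrix.fromCols (0 : Matrix ι' Unit k) (1 : Matrix ι' ι' k) := by
        rw [Matrix.fromRows_mul, Matrix.fromRows_mul_fromCols]
        simp
      rw [hf]
      exact (Matrix.rank_mul_le_left _ _).trans (Matrix.rank_mul_le_right _ _)
    rw [← hYnf, h1] at h2
    omega
  -- the transported data
  set B : Matrix (Unit ⊕ ι') (Unit ⊕ ι') k := Pᵀ * A₀ * P with hBdef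
  have hBs : Bᵀ = B := hsymm A₀ hA₀s
  have hBnf := eq_fromBlocks_of_col hBs rfl (b := fun i => B (Sum.inr i) (Sum.inl ())) fun i => rfl
  have hEs : (B.toBlocks₂₂)ᵀ = B.toBlocks₂₂ := by
    ext i j
    simp only [Matrix.toBlocks₂₂, Matrix.transpose_apply, Matrix.of_apply]
    rw [← hBs, Matrix.transpose_apply, hBs]
  let M' : V →ₗ[k] Matrix (Unit ⊕ ι') (Unit ⊕ ι') k :=
    { toFun := fun v => Pᵀ * M v * P
      map_add' := fun v₁ v₂ => by simp only [map_add, Matrix.mul_add, Matrix.add_mul]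
      map_smul' := fun c v => by
        simp only [map_smul, Matrix.mul_smul, Matrix.smul_mul, RingHom.id_apply] }
  have hM' : ∀ v, M' v = Pᵀ * M v * P := fun v => rfl
  refine eq_zero_of_det_add_smul Δ B.toBlocks₂₂ hΔ hΔs hEs (B (Sum.inl ()) (Sum.inl ()))
    (fun i => B (Sum.inr i) (Sum.inl ())) j M' (fun v => by rw [hM']; exact hsymm _ (hMs v))
    (fun v ν hν => ?_) (fun a b => ?_)
  · -- the identity, conjugated by `P`
    rw [← hBnf, hM', ← hYnf, hBdef]
    have e1 : Pᵀ * Y * P + Pᵀ * M v * P + ν • (Pᵀ * A₀ * P) = Pᵀ * (Y + M v + ν • A₀) * P := by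
      simp only [Matrix.mul_add, Matrix.add_mul, Matrix.mul_smul, Matrix.smul_mul]
    have e2 : Pᵀ * Y * P + Pᵀ * M v * P = Pᵀ * (Y + M v) * P := by
      simp only [Matrix.mul_add, Matrix.add_mul]
    rw [e1, e2, Matrix.det_mul, Matrix.det_mul, Matrix.det_mul, Matrix.det_mul, hH v ν hν]
    ring
  · -- surjectivity of the first-column map
    obtain ⟨v, hv⟩ := hS (Pᵀ⁻¹ *ᵥ Sum.elim (fun _ => a) b)
    have hfirst : ∀ i, M' v i (Sum.inl ()) = Sum.elim (fun _ => a) b i := by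
      intro i
      rw [hM', hcol, hv, Matrix.mulVec_mulVec, Matrix.mul_nonsing_inv _ hPtu, Matrix.one_mulVec]
    exact ⟨v, hfirst _, fun i => hfirst _⟩

/-- **Bridge, general index.** Reindex `ι ≃ Unit ⊕ {i // i ≠ i₀}` with `w i₀ ≠ 0` and apply
`eq_zero_of_kernelRow_surjective_sum`. [folklore] -/
theorem eq_zero_of_kernelRow_surjective {ι : Type*} [Fintype ι] [DecidableEq ι]
    (Y A₀ : Matrix ι ι k) (hYs : Yᵀ = Y) (hA₀s : A₀ᵀ = A₀) (w : ι → k) (hw : w ≠ 0)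
    (hYw : Y *ᵥ w = 0) (hrank : Fintype.card ι ≤ Y.rank + 1) (M : V →ₗ[k] Matrix ι ι k)
    (hMs : ∀ v, (M v)ᵀ = M v) (j : ℕ)
    (hH : ∀ (v : V) (ν : k), ν ≠ -1 → (Y + M v + ν • A₀).det = (1 + ν) ^ j * (Y + M v).det)
    (hS : ∀ u : ι → k, ∃ v, M v *ᵥ w = u) : j = 0 := by
  classical
  obtain ⟨i₀, hi₀⟩ : ∃ i, w i ≠ 0 := Function.ne_iff.mp hw
  -- the reindexing `ι ≃ Unit ⊕ {i // i ≠ i₀}` sending `i₀` to `inl ()`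
  let e : ι ≃ Unit ⊕ {i // i ≠ i₀} :=
    { toFun := fun i => if h : i = i₀ then Sum.inl () else Sum.inr ⟨i, h⟩
      invFun := Sum.elim (fun _ => i₀) fun i => i.1
      left_inv := fun i => by
        by_cases h : i = i₀
        · simp [h]
        · simp [h]
      right_inv := by
        rintro (u | ⟨i, hi⟩)
        · simp
        · simp [hi] }
  have he0 : e.symm (Sum.inl ()) = i₀ := rfl
  set w' : Unit ⊕ {i // i ≠ i₀} → k := w ∘ e.symm with hw'
  have hre : ∀ N : Matrix ι ι k, Matrix.reindex e e N *ᵥ w' = (N *ᵥ w) ∘ e.symm := by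
    intro N
    rw [Matrix.reindex_apply, Matrix.submatrix_mulVec_equiv]
    have hwe : w' ∘ e.symm.symm = w := by
      ext i
      simp [hw']
    rw [hwe]
  let R : Matrix ι ι k →ₗ[k] Matrix (Unit ⊕ {i // i ≠ i₀}) (Unit ⊕ {i // i ≠ i₀}) k :=
    (Matrix.reindexLinearEquiv k k e e).toLinearMap
  have hR : ∀ N, R N = Matrix.reindex e e N := fun N => rfl
  refine eq_zero_of_kernelRow_surjective_sum (Matrix.reindex e e Y) (Matrix.reindex e e A₀)
    (by rw [Matrix.transpose_reindex, hYs]) (by rw [Matrix.transpose_reindex, hA₀s]) w'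
    (by rw [hw', Function.comp_apply, he0]; exact hi₀)
    (by rw [hre, hYw]; rfl) ?_ (R ∘ₗ M) (fun v => ?_) j (fun v ν hν => ?_) (fun u => ?_)
  · have hc : Fintype.card ι = Fintype.card (Unit ⊕ {i // i ≠ i₀}) := Fintype.card_congr e
    rw [Fintype.card_sum, Fintype.card_unit] at hc
    rw [Matrix.rank_reindex]
    omega
  · rw [LinearMap.comp_apply, hR, Matrix.transpose_reindex, hMs]
  · rw [LinearMap.comp_apply, hR]
    have h := hH v ν hν
    simp only [Matrix.reindex_apply]
    have e3 : Y.submatrix e.symm e.symm + (M v).submatrix e.symm e.symm +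
        ν • A₀.submatrix e.symm e.symm = (Y + M v + ν • A₀).submatrix e.symm e.symm := rfl
    have e4 : Y.submatrix e.symm e.symm + (M v).submatrix e.symm e.symm =
        (Y + M v).submatrix e.symm e.symm := rfl
    rw [e3, e4, Matrix.det_submatrix_equiv_self, Matrix.det_submatrix_equiv_self, h]
  · obtain ⟨v, hv⟩ := hS (u ∘ e)
    refine ⟨v, ?_⟩
    rw [LinearMap.comp_apply, hR, hre, hv]
    ext i
    simp

end Bridge

/-! ### The rank bound -/

section Main

variable [CharZero k]

omit [CharZero k] in
/-- A form of degree `n` scales as `f (c • z) = c ^ n f (z)`. [folklore] -/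
theorem eval_smul_of_isHomogeneous {σ : Type*} {f : MvPolynomial σ k} {n : ℕ}
    (hf : f.IsHomogeneous n) (c : k) (z : σ → k) : eval (c • z) f = c ^ n * eval z f := by
  simp only [MvPolynomial.eval_eq, Finset.mul_sum]
  refine Finset.sum_congr rfl fun s hs => ?_
  have hd : s.degree = n := by
    by_contra h
    exact (MvPolynomial.mem_support_iff.mp hs) (hf.coeff_eq_zero h)
  subst hd
  simp only [Pi.smul_apply, smul_eq_mul, mul_pow, Finset.prod_mul_distrib,
    Finset.prod_pow_eq_pow_sum, Finsupp.degree_apply]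
  ring

/-- **Hessian rank drop for homogeneous symmetric determinants.** If `f` is homogeneous of degree
`n`, `A` is a symmetric affine determinantal representation of `f` of size `|ι| ≠ n` (`n ≤ |ι|`),
and `x` is a zero of `f` with `rank A(x) ≥ |ι| - 1`, then `rank Hess f (x) ≤ |ι|` (the symmetric
Mignon–Ressayre bound `|ι| + 1` is not attained). [folklore] -/
theorem rank_hessianMatrix_le_card_of_isHomogeneous {σ : Type*} [Fintype σ] [DecidableEq σ]
    {ι : Type*} [Fintype ι] [DecidableEq ι] {f : MvPolynomial σ k} {n : ℕ}
    (hf : f.IsHomogeneous n) {A : Matrix ι ι (MvPolynomial σ k)} (hAs : A.IsSymm)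
    (hA : IsAffineDetRepr f A) (x : σ → k) (hx : eval x f = 0)
    (hcork : Fintype.card ι ≤ (A.map (eval x)).rank + 1) (hnm : n ≤ Fintype.card ι)
    (hne : Fintype.card ι ≠ n) : (hessianMatrix f x).rank ≤ Fintype.card ι := by
  classical
  obtain ⟨hdeg, hdet⟩ := hA
  -- the affine chain rule `Hess f (x) = Lᵀ · Hess DET (Y) · L`
  have hfa : f = aeval (fun p : ι × ι => A p.1 p.2) (detPoly ι k) := by
    rw [detPoly, AlgHom.map_det, mvPolynomialX_mapMatrix_aeval k A, hdet]
  have hφ : ∀ (t : ι × ι) (u v : σ), pderiv u (pderiv v (A t.1 t.2)) = 0 := fun t u v =>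
    pderiv_pderiv_eq_zero_of_totalDegree_le_one (hdeg t.1 t.2) u v
  rw [hfa, hessianMatrix_aeval_of_affine _ hφ]
  set Y : Matrix ι ι k := Matrix.of fun i j => eval x (A i j) with hYdef
  have hYA : A.map (eval x) = Y := by
    ext i j
    rfl
  have hYdet : Y.det = 0 := by
    have hmap : (MvPolynomial.eval x).mapMatrix A = Y := by
      ext i j
      rfl
    rw [← hmap, ← RingHom.map_det, hdet, hx]
  have hYs : Y.IsSymm := Matrix.IsSymm.ext fun i j => by
    simp only [hYdef, of_apply, hAs.apply i j]
  obtain ⟨w, hw, hwY⟩ := Matrix.exists_mulVec_eq_zero_iff.mpr hYdet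
  have hwY' : w ᵥ* Y = 0 := by
    rw [← hYs.eq, vecMul_transpose, hwY]
  refine le_trans (rank_transpose_mul_mul_le_rank_add_one _ w hw (fun Z Z' h1 h2 h3 => ?_) _
    (fun i j v => by simp only [of_apply, hAs.apply i j])) ?_
  · exact Summit.ValiantsHypothesis.Theorems.dotProduct_hessianMatrix_detPoly_mulVec_eq_zero_of_two_sided
      Y (Matrix.of fun i j => Z (i, j)) (Matrix.of fun i j => Z' (i, j)) w hw hwY' hwY h1 h2 h3
  set Pw : Matrix ι (ι × ι) k := Matrix.of fun (j : ι) (q : ι × ι) => if q.2 = j then w q.1 else 0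
    with hPw
  set L : Matrix (ι × ι) σ k := Matrix.of fun (t : ι × ι) (v : σ) => eval x (pderiv v (A t.1 t.2))
    with hLdef
  by_contra hlt
  have hr : (Pw * L).rank = Fintype.card ι :=
    le_antisymm (Matrix.rank_le_card_height _) (by omega)
  -- the kernel-row map `y ↦ M(y) w` is onto
  have hsurj : ∀ u : ι → k, ∃ y : σ → k, (Pw * L) *ᵥ y = u := by
    intro u
    have htop : LinearMap.range (Pw * L).mulVecLin = ⊤ := by
      apply Submodule.eq_top_of_finrank_eq
      rw [Module.finrank_fintype_fun_eq_card]
      exact hr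
    have hu : u ∈ LinearMap.range (Pw * L).mulVecLin := htop ▸ Submodule.mem_top
    obtain ⟨y, hy⟩ := hu
    exact ⟨y, hy⟩
  -- the pencil `A = A₀ + Σ_v X_v A_v`
  set A₀ : Matrix ι ι k := constPart A with hA₀
  let Mlin : (σ → k) →ₗ[k] Matrix ι ι k :=
    { toFun := fun z => ∑ v, z v • LRPencil.coeffMat A v
      map_add' := fun z₁ z₂ => by
        simp only [Pi.add_apply, add_smul, Finset.sum_add_distrib]
      map_smul' := fun c z => by
        simp only [Pi.smul_apply, smul_eq_mul, mul_smul, Finset.smul_sum, RingHom.id_apply] }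
  have hMlin : ∀ z, Mlin z = ∑ v, z v • LRPencil.coeffMat A v := fun z => rfl
  have hAz : ∀ z, A.map (eval z) = A₀ + Mlin z := fun z => by
    rw [hMlin, hA₀]
    exact LRPencil.map_eval_eq A hdeg z
  have hdetz : ∀ z, (A₀ + Mlin z).det = eval z f := fun z => by
    rw [← hAz, ← RingHom.mapMatrix_apply, ← RingHom.map_det, hdet]
  have hY : Y = A₀ + Mlin x := by rw [← hYA, hAz]
  have hcoeffs : ∀ v, (LRPencil.coeffMat A v)ᵀ = LRPencil.coeffMat A v := fun v => by
    ext i j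
    simp only [transpose_apply, LRPencil.coeffMat_apply, hAs.apply i j]
  have hA₀s : A₀ᵀ = A₀ := by
    ext i j
    simp only [hA₀, transpose_apply, constPart_apply, hAs.apply i j]
  have hMs : ∀ z, (Mlin z)ᵀ = Mlin z := fun z => by
    rw [hMlin, Matrix.transpose_sum]
    exact Finset.sum_congr rfl fun v _ => by rw [Matrix.transpose_smul, hcoeffs]
  -- `(P_w L) y = M(y) w`
  have hPZ : ∀ Z : ι × ι → k, Pw *ᵥ Z = w ᵥ* (Matrix.of fun i j => Z (i, j)) := by
    intro Z
    ext j
    simp only [hPw, mulVec, dotProduct, of_apply, vecMul, ite_mul, zero_mul]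
    rw [Fintype.sum_prod_type]
    simp only [Finset.sum_ite_eq', Finset.mem_univ, if_true]
  have hLM : ∀ y : σ → k, (Matrix.of fun i j => (L *ᵥ y) (i, j)) = Mlin y := by
    intro y
    ext i j
    simp only [of_apply, mulVec, dotProduct, hLdef, hMlin, Matrix.sum_apply, Matrix.smul_apply,
      smul_eq_mul, LRPencil.coeffMat_apply, AlperBogartVelasco.pderiv_eq_C_coeff (hdeg i j),
      eval_C]
    exact Finset.sum_congr rfl fun v _ => mul_comm _ _
  have hPwL : ∀ y : σ → k, (Pw * L) *ᵥ y = Mlin y *ᵥ w := by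
    intro y
    rw [← Matrix.mulVec_mulVec, hPZ, hLM]
    conv_lhs => rw [← hMs y]
    rw [vecMul_transpose]
  -- the homogeneity identity
  obtain ⟨d, hd⟩ : ∃ d, Fintype.card ι = d + n := ⟨Fintype.card ι - n, by omega⟩
  have hHom : ∀ (y : σ → k) (ν : k), ν ≠ -1 →
      (Y + Mlin y + ν • A₀).det = (1 + ν) ^ d * (Y + Mlin y).det := by
    intro y ν hν
    have h1 : (1 + ν : k) ≠ 0 := fun h => hν (by linear_combination h)
    have hmat : Y + Mlin y + ν • A₀ = (1 + ν) • (A₀ + Mlin ((1 + ν)⁻¹ • (x + y))) := by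
      rw [hY, map_smul, map_add, smul_add, smul_smul, mul_inv_cancel₀ h1, one_smul, add_smul,
        one_smul]
      abel
    have hYM : Y + Mlin y = A₀ + Mlin (x + y) := by rw [hY, map_add, add_assoc]
    rw [hmat, Matrix.det_smul, hdetz, eval_smul_of_isHomogeneous hf, hYM, hdetz, hd, pow_add,
      mul_assoc, ← mul_assoc ((1 + ν) ^ n), ← mul_pow, mul_inv_cancel₀ h1, one_pow, one_mul]
  have hj := eq_zero_of_kernelRow_surjective Y A₀ hYs.eq hA₀s w hw hwY (by rwa [hYA] at hcork)
    Mlin hMs d hHom fun u => by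
      obtain ⟨y, hy⟩ := hsurj u
      exact ⟨y, by rw [← hPwL, hy]⟩
  omega

end Main

end Summit.ValiantsHypothesis.ValiantsHypothesis.Theorems.SymPencilHomogeneousHessianRank

end
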